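import Literature.AnabelianGeometry.EtaleTheta.SettingModelTateCyclotomes
import Literature.AnabelianGeometry.EtaleTheta.XuuCocycleNormal
import HarnessLib

/-!
# The stage-2 («Tate shear») root model of [EtTh] §1 (R78), row #5 continued: the choice `X̲̲` (Def. 2.5 (i)) EXISTS
# at `ThetaSetting.modelχq p i j` from the Kummer-layer inputs alone — the STAGE-2 home of the facts route

Mochizuki, *The Étale Theta Function …* [EtTh], Publ. RIMS **45** (2009), Def. 2.5 (i) p. 39, Def. 2.7 p. 41,
Prop. 1.5 (ii)/(iii) p. 23 (PRIMS PDF pages).  Cell abc-iut, layer L2, seat abc-iut-L2-t8 (owner of `DoubleUnderline.lean`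
and of the §1 → §2 adapter); R78 cluster row #5.  PROOF-ONLY (0 definitions).

`SettingModelChiDoubleUnderlineOfFacts.lean` (this seat) records the facts route to `X̲̲` at the STAGE-1 model `modelχ`:
abc-iut-L2-t7's `nonempty_doubleUnderline_of_sectionOneFacts` with the guard and the cyclotome input discharged, leaving
`Compat` / `Sec2Hyps` / Prop. 1.5 (iii) / Prop. 1.5 (ii) as binders.  abc-iut-L2-t12 has since certified that **Prop. 1.5 (iii)
FAILS at stage 1** for every class of the χ-model's Kummer family (`SettingModel.not_prop15iii_etaleThetaDataχSec`: conjugation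
by the deck generator produces no `κ(q̈)^{−a²}` term when the Galois action is the pure twist `θ_χ`), so the stage-1 statement is
vacuous there by design; the Tate SHEAR of stage 2 (`modelχq p i j`, abc-iut-L2-t5 F5q; designated Tate instance
`modelχq p 1 2` / its mirror) is where Prop. 1.5 (iii) is expected (F7q).  This file states the facts route AT STAGE 2, for
every `(i, j)` with `j` even: the guard (`modelχq_isEtThOrigin`) and the cyclotome input (`modelχq_nonempty_cyclotomeMod`, over
abc-iut-L6-d6's `deltaThetaCoordχq`) are THEOREMS, `Compat` holds for every setting (abc-iut `ThetaSetting.compat`), so `X̲̲` exists at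
`modelχq` for every étale theta datum `E` there satisfying `Sec2Hyps` + Prop. 1.5 (iii) + Prop. 1.5 (ii), and is Galois over `X̲`
when `μ_l ⊆ K`.  HONEST LABEL: semi-synthetic model — consistency evidence for the typed interface; the binders are NOT claimed
satisfiable here (that is F7q's census); nothing of [EtTh] asserted; no side taken on [IUTchIII] Cor. 3.12; typed ≠ endorsed.
-/

noncomputable section

namespace Literature.AnabelianGeometry.EtaleTheta.SettingModel

open Literature.AnabelianGeometry.SemiGraphs

variable (p : ℕ) [Fact p.Prime] (i j : ℤ) (hj : Even j)

/-- **A cyclotome input `μ : CyclotomeMod 1 l` EXISTS at the stage-2 model** (the `l = 1` level of row #5's family).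
[cite: MochizukiEtTh2009, §2 p.46] -/
theorem modelχq_nonempty_cyclotomeMod_one (l : ℕ+) : Nonempty ((ThetaSetting.modelχq p i j hj).CyclotomeMod 1 l) :=
  modelχq_nonempty_cyclotomeMod p i j hj Nat.one_pos l

/-- **`X̲̲` EXISTS at the stage-2 model from the Kummer-layer inputs alone** (Def. 2.5 (i)): for every étale theta datum `E`
over `modelχq p i j` with `Sec2Hyps`, Prop. 1.5 (iii), Prop. 1.5 (ii) (relative to ANY `hC`, e.g. `ThetaSetting.compat _`) and
`l` odd, a choice `E.DoubleUnderline l` exists. [cite: MochizukiEtTh2009, Def 2.5 (i) p.39] -/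
theorem modelχq_nonempty_doubleUnderline {E : (ThetaSetting.modelχq p i j hj).EtaleThetaData}
    (hC : (ThetaSetting.modelχq p i j hj).Compat) (hS : (ThetaSetting.modelχq p i j hj).Sec2Hyps)
    (h15 : ThetaSetting.Prop15iii E hC) (h15ii : ThetaSetting.Prop15ii E.toKummerData hC)
    {l : ℕ+} (hl : Odd (l : ℕ)) : Nonempty (E.DoubleUnderline l) := by
  obtain ⟨μ⟩ := modelχq_nonempty_cyclotomeMod_one p i j hj l
  exact ThetaSetting.EtaleThetaData.nonempty_doubleUnderline_of_sectionOneFacts hC hS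
    (ThetaSetting.modelχq_isEtThOrigin p i j hj) h15 h15ii μ hl

/-- **… and `X̲̲ → X̲` is GALOIS when `μ_l ⊆ K`** (`K = ℚ_p` at the model, so iff `l ∣ p − 1`).
[cite: MochizukiEtTh2009, Def 2.5 (i) p.39] -/
theorem modelχq_exists_doubleUnderline_normal {E : (ThetaSetting.modelχq p i j hj).EtaleThetaData}
    (hC : (ThetaSetting.modelχq p i j hj).Compat) (hS : (ThetaSetting.modelχq p i j hj).Sec2Hyps)
    (h15 : ThetaSetting.Prop15iii E hC) (h15ii : ThetaSetting.Prop15ii E.toKummerData hC)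
    {l : ℕ+} (hl : Odd (l : ℕ))
    (hμK : ∀ ζ : MuN p l, (((ζ : (PadicAlgCl p)ˣ) : PadicAlgCl p)) ∈ (ThetaSetting.modelχq p i j hj).K) :
    ∃ C : E.DoubleUnderline l, (C.Huu.subgroupOf ((ThetaSetting.modelχq p i j hj).GtpXu l)).Normal := by
  obtain ⟨μ⟩ := modelχq_nonempty_cyclotomeMod_one p i j hj l
  exact ThetaSetting.EtaleThetaData.exists_doubleUnderline_normal_of_sectionOneFacts hC hS
    (ThetaSetting.modelχq_isEtThOrigin p i j hj) h15 h15ii μ hl hμK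

end Literature.AnabelianGeometry.EtaleTheta.SettingModel

end
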